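import Summits.ValiantsHypothesis.ValiantsHypothesis.Theses.IntegralGCT

/-!
# Route IntegralGCT — `IntegralRefinesMultiplicity` (item stmt-ValiantsHypothesis-0981)

An intertwining map `φ : ℂ[Δ f]_d → ℂ[Δ g]_d` whose image of the integral lattice of
`ℂ[Δ f]_d` is the integral lattice of `ℂ[Δ g]_d` (classes of integer degree-`d` forms in the
coefficient coordinates) is surjective: the degree-`d` piece `ℂ[Δ g]_d` is the image of the
homogeneous degree-`d` forms, which are spanned over `ℂ` by the degree-`d` monomials, and every
monomial is (the base change of) an integer form, hence lies in the lattice and so in the range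
of `φ`. Consequently a multiplicity obstruction implies an integral obstruction.
[Bürgisser–Ikenmeyer–Panova 2019, §1; Bürgisser–Landsberg–Manivel–Weyman 2011, §2 — the
surjection template; the integral refinement is elementary linear algebra.]
-/

set_option linter.dupNamespace false

namespace Summit.ValiantsHypothesis.ValiantsHypothesis.Theorems

open MvPolynomial Literature.Computability.AlgebraicComplexity

/-- **Integral obstructions refine multiplicity obstructions.** If a `GL`-intertwining map
`φ : ℂ[Δ f]_d → ℂ[Δ g]_d` carries the lattice of classes of integer degree-`d` forms of
`ℂ[Δ f]_d` onto that of `ℂ[Δ g]_d`, then `φ` is surjective, because the classes of the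
degree-`d` monomials (integer forms) span `ℂ[Δ g]_d` over `ℂ`. Closes route item
stmt-ValiantsHypothesis-0981 (`IntegralRefinesMultiplicity`) of route IntegralGCT. -/
theorem integralRefinesMultiplicity_proof :
    Summit.ValiantsHypothesis.ValiantsHypothesis.Theses.IntegralGCT.IntegralRefinesMultiplicity := by
  intro σ _ _ f g m d φ hφ
  -- every element of `ℂ[Δ g]_d` lies in the image of `range φ` inside `ℂ[Δ g]`
  have key : ∀ y ∈ orbitCoordRingDeg g m d,
      y ∈ (LinearMap.range φ.toLinearMap).map (orbitCoordRingDeg g m d).subtype := by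
    intro y hy
    have hy' : y ∈ (homogeneousSubmodule (DegIdx σ m) ℂ d).map
        (Ideal.Quotient.mkₐ ℂ (orbitVanishingIdeal g m)).toLinearMap := hy
    rw [homogeneousSubmodule_eq_finsupp_supported, AddMonoidAlgebra.supported_eq_span_single,
      Submodule.map_span] at hy'
    refine (Submodule.span_le.mpr ?_) hy'
    rintro _ ⟨_, ⟨e, he, rfl⟩, rfl⟩
    -- the monomial `X^e` is an integer form of degree `d`, so its class lies in the lattice,
    -- hence in the image of `φ`
    obtain ⟨x, -, hx⟩ := (Set.ext_iff.mp hφ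
      (Ideal.Quotient.mk (orbitVanishingIdeal g m)
        (MvPolynomial.map (Int.castRingHom ℂ) (monomial e (1 : ℤ))))).mpr
      ⟨monomial e (1 : ℤ), isHomogeneous_monomial _ he, rfl⟩
    refine ⟨φ x, LinearMap.mem_range_self _ x, ?_⟩
    rw [map_monomial, map_one] at hx
    simpa [single_eq_monomial, Ideal.Quotient.mkₐ_eq_mk] using hx
  intro y
  obtain ⟨z, ⟨x, rfl⟩, hzy⟩ := key y y.2
  exact ⟨x, Subtype.ext hzy⟩

end Summit.ValiantsHypothesis.ValiantsHypothesis.Theorems
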